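import Summits.ResolutionOfSingularities.ResolutionOfSingularities.Theorems.DescentDescentPerfectToAllLevelResolution
import Summits.ResolutionOfSingularities.ResolutionOfSingularities.Theorems.DescentDescentPerfectToAllFgModel
import Summits.ResolutionOfSingularities.ResolutionOfSingularities.Theorems.DescentDescentPerfectToAllRobustModel
import Summits.ResolutionOfSingularities.ResolutionOfSingularities.Theorems.WeightedInvariantDescentReducedToIntegral
import Literature.AlgebraicGeometry.Resolution.SmoothOfRegularPerfectField
import Literature.AlgebraicGeometry.Resolution.SmoothStalksRegular
import Mathlib.FieldTheory.PurelyInseparable.PerfectClosure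
import Mathlib.FieldTheory.IsPerfectClosure
import HarnessLib

/-!
# Crux `PrimeFieldToPerfect`, line `birth`: stub `stub_separableDescent`

Route `ResolutionOfSingularities/UniversalCells`, crux `PrimeFieldToPerfect`
(stmt-ResolutionOfSingularities-15233), stub `stub_separableDescent` of the lead's skeleton, PROVED
here (statement verbatim from the ledger registration). The crux: resolution of integral
separated schemes of finite type over `Spec 𝔽_p` implies resolution over every perfect field of
characteristic `p`. This file proves the step "perfect closures of finitely generated fields ⇒
all perfect fields" of the lead's skeleton.

**Statement.** Fix a prime `p` and assume (`h`): for every field `K` of characteristic `p`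
generated by a finite set and every perfect field `L` purely inseparable over `K` (i.e.
`L ≅ K^{perf}`), every integral separated `L`-scheme of finite type admits a resolution of
singularities. Then every integral separated scheme `X` of finite type over a PERFECT field `k` of
characteristic `p` admits a resolution.

**Proof (separable descent).**
1. *Spreading out* (`stub_fgModel`, EGA IV₃ 8.8.2): `X ≅ X₀ ×_{K₀} Spec k` for a finitely
   generated subfield `K₀ = closure s ⊆ k` and a separated finite type `f₀ : X₀ → Spec K₀`.
2. Let `L := perfectClosure K₀ k ⊆ k`, the relative perfect closure: it is perfect (as `k` is)
   and purely inseparable over `K₀` (Mathlib `perfectClosure.perfectField`,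
   `perfectClosure.isPurelyInseparable`). Put `X_L := X₀ ×_{K₀} Spec L`.
3. `X ≅ X_L ×_L Spec k → X_L` is flat and surjective (base change of `Spec k → Spec L`), so
   `X_L` is integral (reducedness descends along faithfully flat maps, irreducibility along
   surjections). By `h`, `X_L` has a resolution `π : Y → X_L`.
4. `Y` is regular and locally of finite type over the perfect field `L`, hence `Y → Spec L` is
   smooth (`smooth_of_isRegular_of_perfectField`, Matsumura §30 / Stacks 00TV); so its base change
   `Y ×_L k → Spec k` is smooth and `Y ×_L k` is regular
   (`isRegularLocalRing_stalk_of_smooth_of_field`, Stacks 056S). This is the point of passing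
   through `L`: the extension `k / L` is separable (`L` perfect), so regularity survives the base
   change.
5. `stub_resolutionOfRobustModel`: the base change of the proper birational `π` to `k` is a
   resolution of `X₀ ×_{K₀} Spec k ≅ X` (flat base change preserves birationality between
   Noetherian schemes).

## Sources

* Q. Liu, *Algebraic Geometry and Arithmetic Curves* (2002), Prop. 3.2.7 (base change to the
  perfect closure) and Cor. 4.3.33 (smooth ⇔ regular after base change, over perfect fields).
  [Liu2002]
* H. Matsumura, *Commutative Ring Theory* (1987), §30 Remark 2 after Thm. 30.3. [Matsumura1987]
* The Stacks Project, Tags 00TV, 056S, 01ZM.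
-/

noncomputable section

set_option linter.dupNamespace false -- mandated namespace of this single-conjunct summit

open CategoryTheory CategoryTheory.Limits AlgebraicGeometry TopologicalSpace
open Literature.AlgebraicGeometry.Resolution

namespace Summit.ResolutionOfSingularities.ResolutionOfSingularities.Theorems.PrimeFieldToPerfect

universe u

/-- **Separable descent** (perfect closures of finitely generated fields ⇒ all perfect fields):
if, for every finitely generated field `K` of characteristic `p` and every perfect field `L`
purely inseparable over `K`, integral separated `L`-schemes of finite type admit resolutions, then
so do integral separated schemes of finite type over any perfect field `k` of characteristic `p`.
Proof: spread `X` out to `X₀ / K₀` with `K₀ ⊆ k` finitely generated, resolve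
`X₀ ×_{K₀} L` over the relative perfect closure `L` of `K₀` in `k`, and base change along the
separable extension `k / L`, under which the regular (= smooth over the perfect `L`) source stays
regular. [cite: Liu2002, Prop. 3.2.7 and Cor. 4.3.33] -/
theorem stub_separableDescent (p : ℕ) (hp : p.Prime) (h : ∀ (K : Type) [Field K] [CharP K p], (∃ s : Finset K, Subfield.closure (s : Set K) = ⊤) → ∀ (L : Type) [Field L] [PerfectField L] [Algebra K L] [IsPurelyInseparable K L] (X : Scheme.{0}) (f : X ⟶ Spec (.of L)), IsSeparated f → LocallyOfFiniteType f → QuasiCompact f → IsIntegral X → Scheme.HasResolution X) (k : Type) [Field k] [CharP k p] [PerfectField k] (X : Scheme.{0}) (f : X ⟶ Spec (.of k)) (hs : IsSeparated f) (hl : LocallyOfFiniteType f) (hq : QuasiCompact f) (hX : IsIntegral X) : Scheme.HasResolution X := by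
  -- the primality of `p` is part of the registered signature but not needed by the argument
  have _ : Fact p.Prime := ⟨hp⟩
  classical
  -- ### Step 1: spread `X` out to a model `X₀` over a finitely generated subfield `K₀ ⊆ k`
  obtain ⟨K₀, s, hK₀, X₀, f₀, hsep, hlft, hqc, -, ⟨e⟩⟩ :=
    Summit.ResolutionOfSingularities.ResolutionOfSingularities.Theorems.stub_fgModel k X f hs hl hq
      inferInstance
  -- `K₀` is generated, as a field, by the finite set `s ⊆ K₀`
  have hFG : ∃ s' : Finset K₀, Subfield.closure (↑s' : Set K₀) = ⊤ := by
    refine ⟨s.subtype (· ∈ K₀), eq_top_iff.2 fun x _ => ?_⟩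
    have hle : Subfield.closure (↑s : Set k) ≤
        (Subfield.closure (↑(s.subtype (· ∈ K₀)) : Set K₀)).map K₀.subtype :=
      Subfield.closure_le.2 fun y hy => by
        have hyK : y ∈ K₀ := by
          rw [hK₀]
          exact Subfield.subset_closure hy
        exact Subfield.mem_map.2 ⟨⟨y, hyK⟩,
          Subfield.subset_closure (Finset.mem_coe.2 (Finset.mem_subtype.2 (Finset.mem_coe.1 hy))),
          rfl⟩
    have hx : (x : k) ∈ Subfield.closure (↑s : Set k) := by
      rw [← hK₀]
      exact x.2
    obtain ⟨y, hy, hyx⟩ := Subfield.mem_map.1 (hle hx)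
    have hyx' : y = x := Subtype.ext hyx
    exact hyx' ▸ hy
  -- ### Step 2: the relative perfect closure `L` of `K₀` in `k`
  let L : Subfield k := (perfectClosure K₀ k).toSubfield
  have hL : K₀ ≤ L := fun x hx => (perfectClosure K₀ k).algebraMap_mem ⟨x, hx⟩
  haveI : PerfectField L := inferInstanceAs (PerfectField (perfectClosure K₀ k))
  letI : Algebra K₀ L := (perfectClosure K₀ k).algebra
  haveI : IsPurelyInseparable K₀ L := perfectClosure.isPurelyInseparable K₀ k
  -- ### Step 3: `X_L := X₀ ×_{K₀} Spec L` is integral, as `X ≅ X_L ×_L Spec k → X_L` is flat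
  -- and surjective
  let iL : Spec (.of L) ⟶ Spec (.of K₀) := Spec.map (CommRingCat.ofHom (Subfield.inclusion hL))
  let jL : Spec (.of k) ⟶ Spec (.of L) := Spec.map (CommRingCat.ofHom L.subtype)
  let XL : Scheme.{0} := pullback f₀ iL
  let gL : XL ⟶ Spec (.of L) := pullback.snd f₀ iL
  have hK : L.subtype.comp (Subfield.inclusion hL) = K₀.subtype := RingHom.ext fun _ => rfl
  have e' : jL ≫ iL = Spec.map (CommRingCat.ofHom K₀.subtype) := by
    rw [← Spec.map_comp, ← CommRingCat.ofHom_comp, hK]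
  let eK : pullback gL jL ≅ pullback f₀ (Spec.map (CommRingCat.ofHom K₀.subtype)) :=
    pullbackLeftPullbackSndIso f₀ iL jL ≪≫ pullback.congrHom rfl e'
  haveI : Flat jL := by
    rw [Flat.SpecMap_iff, CommRingCat.hom_ofHom]
    exact RingHom.flat_algebraMap_iff.mpr (inferInstance : Module.Flat L k)
  haveI : Surjective jL := by
    haveI : Subsingleton ↥(Spec (CommRingCat.of L)) :=
      inferInstanceAs (Subsingleton (PrimeSpectrum L))
    haveI : Nonempty ↥(Spec (CommRingCat.of k)) := inferInstanceAs (Nonempty (PrimeSpectrum k))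
    infer_instance
  let c : X ⟶ XL := e.hom ≫ eK.inv ≫ pullback.fst gL jL
  haveI : Flat c := inferInstance
  haveI : Surjective c := inferInstance
  haveI : IsIntegral XL := by
    haveI : IsReduced XL :=
      Literature.AlgebraicGeometry.Morphisms.isReduced_of_flat_of_surjective c
    haveI : IrreducibleSpace XL := c.surjective.irreducibleSpace c.continuous
    exact isIntegral_of_irreducibleSpace_of_isReduced XL
  -- ### Step 4: resolve `X_L` over the perfect closure `L` of the finitely generated `K₀`
  haveI : IsSeparated gL := inferInstance
  haveI : LocallyOfFiniteType gL := inferInstance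
  haveI : QuasiCompact gL := inferInstance
  obtain ⟨Y, π, hres⟩ :=
    h K₀ hFG L XL gL inferInstance inferInstance inferInstance inferInstance
  -- ### Step 5: `Y → Spec L` is smooth (regular over a perfect field), so `Y ×_L k` is regular
  haveI := hres.isProper
  haveI : Smooth (π ≫ gL) := smooth_of_isRegular_of_perfectField (π ≫ gL) hres.isRegular
  have hreg : Scheme.IsRegular (pullback (π ≫ gL) jL) := fun y =>
    isRegularLocalRing_stalk_of_smooth_of_field (pullback.snd (π ≫ gL) jL) y
  -- ### Step 6: base change the resolution to `k` and transport along `X ≅ X₀ ×_{K₀} Spec k`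
  have H :=
    Summit.ResolutionOfSingularities.ResolutionOfSingularities.Theorems.stub_resolutionOfRobustModel
      k K₀ L hL X₀ f₀ hsep hlft hqc Y π hres.isProper hres.isBirational hreg
  exact H.of_iso e.inv

end Summit.ResolutionOfSingularities.ResolutionOfSingularities.Theorems.PrimeFieldToPerfect

end
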